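/-
Copyright (c) 2026 the pub-hodgecm-mathlib formalisation cell (harness21).  Prover seat hodgecm-mathlib-K2Liu-p10 (g4), Track B «K2-LIT»,
#184♮ = hLiu418 = `stmt-HodgeConjecture-24832`; (σ) endgame organ, socket σ-5 of ★∕📤 I-4b `faceA4R_two_of_record`: the `IsLocalSiegelSection` FOLD.  KERNEL: theorems only.
-/
import Summits.HodgeConjecture.HodgeConjecture.Theorems.K2LiuLocalSiegelCharacterMul   -- ★ `localSiegelCharacter_mul`
import Literature.NumberTheory.K2Lit.LocalSiegelIntertwining                           -- ★ `localSiegelCharacter_eq_one_of_mem_unipDeltaLocal`, `isSiegelDelta_of_mem_unipDeltaLocal`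
import HarnessLib

/-!
# Crux `HLiu418`, (σ) endgame, socket σ-5: A FUNCTION WITH A LEVI LAW AND UNIPOTENT INVARIANCE IS A SIEGEL SECTION (`P_Δ = M_Δ · N_Δ`)

Cell `hodgecm-mathlib`, crux item hLiu418 = `stmt-HodgeConjecture-24832`, route of record `HCCMUnconditional`; squad K2 ∕ K2Liu, prover K2Liu-p10 (g4).
THEOREMS ONLY; lane `--supports stmt-HodgeConjecture-24832 --as helper`.  ★ K2Lit currency `(F E c hcδ hδ hd v n hT₀ hJD) χv s`.

The last step of V8e's `hSiegS` for the Kudla–Rallis section `B Φ` (★ S-2b `krSection`): **`isLocalSiegelSection_of_levi_unip`** — if `f (m h) = localSiegelCharacter χv s m · f h` for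
`m` in a subgroup `M` of Siegel elements (★ `krSection_levi_mul` + ★ (L3-a) + ★ S-2c (b)(c) + p09's ASK 1), `f (u h) = f h` for `u ∈ N_Δ(F_v)` (★ `krSection_unip_mul` + ★ S-2c (e) +
p02's `hN`), and every Siegel `p` factors as `m · u` (`hdecomp`, the Levi decomposition BY VALUE), then `IsLocalSiegelSection χv s f` (★ `localSiegelCharacter_mul`,
★ `localSiegelCharacter_eq_one_of_mem_unipDeltaLocal`).  Variant **`isLocalSiegelSection_of_levi_unip_hom`** with the Levi given as a hom `mΔ : Γ₁ →* H_v` (V8e's pins).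

HONEST LABEL: HC_CM is proved only modulo the 7 printed citations (2 remaining named inputs: hLiu418 = stmt-HodgeConjecture-24832, h413 = stmt-HodgeConjecture-24833)
until rung 0 closes; helper, closes no item.
References: [HarrisKudlaSweet1996] §1 (1.11), (1.15); [Kudla1994] §3; [Casselman1980] §3.
-/

set_option autoImplicit false
set_option linter.dupNamespace false -- the mandated namespace repeats `HodgeConjecture.HodgeConjecture`

noncomputable section

open NumberField IsDedekindDomain
open Literature.NumberTheory.Automorphic Literature.NumberTheory.Automorphic.UnitaryGroup
open Literature.NumberTheory.GelbartRogawski1991.UnitaryDualPair.LocalSplitting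
open Literature.NumberTheory.K2Lit.LocalSiegelDoubled
open Summit.HodgeConjecture.HodgeConjecture.Cruxes.HLiu418.K2LiuLocalSiegel

namespace Summit.HodgeConjecture.HodgeConjecture.Cruxes.HLiu418.K2LiuA7ValueSocketSiegS

variable (F : Type) [Field F] [NumberField F] (E : Type) [Field E] [NumberField E] [Algebra F E]
  [Algebra.IsQuadraticExtension F E] (c : E ≃ₐ[F] E)
  {δ : E} (hcδ : c δ = -δ) (hδ : δ ≠ 0) {d : F} (hd : δ * δ = algebraMap F E d) (v : HeightOneSpectrum (𝓞 F)) (n : ℕ)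
  {T₀ : Matrix (Fin n) (Fin n) F} (hT₀ : T₀.IsSymm)
  {JD : Matrix (Fin (n + n)) (Fin (n + n)) E} (hJD : JD = (gramD F n T₀).map (algebraMap F E))
  (χv : ∀ w : PlacesOver E v, (w.1.adicCompletion E)ˣ →* ℂˣ) (s : ℂ)

/-- **THE FOLD**: Levi law on a subgroup `M` of Siegel elements + left `N_Δ`-invariance + Levi decomposition ⇒ Siegel section. [cite: HarrisKudlaSweet1996, §1 (1.15)]
[cite: Kudla1994, §3] -/
theorem isLocalSiegelSection_of_levi_unip (f : UnitaryGroup.localPi E c (n + n) JD v → ℂ) (M : Subgroup (UnitaryGroup.localPi E c (n + n) JD v))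
    (hMS : ∀ m ∈ M, IsSiegelDelta F E c hcδ hδ hd v n hT₀ hJD m)
    (hlevi : ∀ m ∈ M, ∀ h, f (m * h) = localSiegelCharacter F E c v n χv s m * f h)
    (hunip : ∀ u ∈ unipDeltaLocal F E c v n (JD := JD), ∀ h, f (u * h) = f h)
    (hdecomp : ∀ p, IsSiegelDelta F E c hcδ hδ hd v n hT₀ hJD p → ∃ m ∈ M, ∃ u ∈ unipDeltaLocal F E c v n (JD := JD), p = m * u) :
    IsLocalSiegelSection F E c hcδ hδ hd v n hT₀ hJD χv s f := by
  intro p hp h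
  obtain ⟨m, hm, u, hu, rfl⟩ := hdecomp p hp
  rw [mul_assoc, hlevi m hm, hunip u hu, localSiegelCharacter_mul F E c hcδ hδ hd v n hT₀ hJD χv s m u (hMS m hm) (isSiegelDelta_of_mem_unipDeltaLocal F E c hcδ hδ hd v n hT₀ hJD hu),
    localSiegelCharacter_eq_one_of_mem_unipDeltaLocal F E c v n χv s hu, mul_one]

/-- **THE FOLD, LEVI AS A HOM** (V8e's pins `mΔ : Γ₁ →* H_v`): with a Levi law along `mΔ` whose character is `localSiegelCharacter χv s ∘ mΔ` (e.g. ★ `krSection_levi_mul` once the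
factor `c_M(a) · mod⁻¹` is identified — ★ (L3-a), ★ S-2c (c), ASK 1), unipotent invariance, and the decomposition `p = mΔ a · u`. [cite: HarrisKudlaSweet1996, §1 (1.15)] -/
theorem isLocalSiegelSection_of_levi_unip_hom (f : UnitaryGroup.localPi E c (n + n) JD v → ℂ) {Γ₁ : Type} [Group Γ₁]
    (mΔ : Γ₁ →* UnitaryGroup.localPi E c (n + n) JD v) (hmΔ : ∀ a, IsSiegelDelta F E c hcδ hδ hd v n hT₀ hJD (mΔ a))
    (hlevi : ∀ (a : Γ₁) (h : UnitaryGroup.localPi E c (n + n) JD v), f (mΔ a * h) = localSiegelCharacter F E c v n χv s (mΔ a) * f h)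
    (hunip : ∀ u ∈ unipDeltaLocal F E c v n (JD := JD), ∀ h, f (u * h) = f h)
    (hdecomp : ∀ p, IsSiegelDelta F E c hcδ hδ hd v n hT₀ hJD p → ∃ (a : Γ₁), ∃ u ∈ unipDeltaLocal F E c v n (JD := JD), p = mΔ a * u) :
    IsLocalSiegelSection F E c hcδ hδ hd v n hT₀ hJD χv s f := by
  intro p hp h
  obtain ⟨a, u, hu, rfl⟩ := hdecomp p hp
  rw [mul_assoc, hlevi a, hunip u hu, localSiegelCharacter_mul F E c hcδ hδ hd v n hT₀ hJD χv s (mΔ a) u (hmΔ a) (isSiegelDelta_of_mem_unipDeltaLocal F E c hcδ hδ hd v n hT₀ hJD hu),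
    localSiegelCharacter_eq_one_of_mem_unipDeltaLocal F E c v n χv s hu, mul_one]

/-- **THE LEVI CHARACTER IDENTIFICATION** feeding `hlevi`: if `f (mΔ a · h) = c_M(a) · r(a) · f h` with `c_M(a) = localSiegelCharacter χv s₁ (mΔ a)` (★ (L3-a)) and
`r(a) · |det_Δ (mΔ a)|_v = 1` (the Jacobian, ★ S-2c (c) + ASK 1), then `f (mΔ a · h) = localSiegelCharacter χv (s₁ − 1) (mΔ a) · f h` — the exponent shift `½ ↦ −½`.
[cite: HarrisKudlaSweet1996, §1 (1.15)–(1.16)] -/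
theorem levi_law_shift (f : UnitaryGroup.localPi E c (n + n) JD v → ℂ) {Γ₁ : Type}
    (mΔ : Γ₁ → UnitaryGroup.localPi E c (n + n) JD v) (hmΔ : ∀ a, IsSiegelDelta F E c hcδ hδ hd v n hT₀ hJD (mΔ a))
    (s₁ : ℂ) (cM : Γ₁ → ℂ) (hcM : ∀ a, cM a = localSiegelCharacter F E c v n χv s₁ (mΔ a)) (r : Γ₁ → ℝ)
    (hr : ∀ a, r a * absDetDelta F E c v n (mΔ a) = 1)
    (hf : ∀ (a : Γ₁) (h : UnitaryGroup.localPi E c (n + n) JD v), f (mΔ a * h) = cM a * ((r a : ℂ) * f h))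
    (a : Γ₁) (h : UnitaryGroup.localPi E c (n + n) JD v) :
    f (mΔ a * h) = localSiegelCharacter F E c v n χv (s₁ - 1) (mΔ a) * f h := by
  rw [hf, hcM, ← mul_assoc]
  congr 1
  unfold localSiegelCharacter
  have hpos : 0 < absDetDelta F E c v n (mΔ a) :=
    Finset.prod_pos fun w _ => norm_pos_iff.2 (isUnit_detDelta F E c hcδ hδ hd v n hT₀ hJD _ (hmΔ a) w).ne_zero
  have hne : ((absDetDelta F E c v n (mΔ a) : ℝ) : ℂ) ≠ 0 := Complex.ofReal_ne_zero.2 hpos.ne'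
  have hra : (r a : ℂ) = ((absDetDelta F E c v n (mΔ a) : ℝ) : ℂ)⁻¹ := by
    refine eq_inv_of_mul_eq_one_left ?_
    rw [← Complex.ofReal_mul, hr, Complex.ofReal_one]
  rw [hra, mul_assoc, show s₁ - 1 + (n : ℂ) / 2 = (s₁ + (n : ℂ) / 2) - 1 by ring, Complex.cpow_sub _ _ hne, Complex.cpow_one]
  simp only [div_eq_mul_inv]

end Summit.HodgeConjecture.HodgeConjecture.Cruxes.HLiu418.K2LiuA7ValueSocketSiegS

end
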